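import Mathlib.Topology.Algebra.Category.ProfiniteGrp.Completion
import Mathlib.GroupTheory.FreeGroup.NielsenSchreier
import Mathlib.GroupTheory.Index
import Mathlib.GroupTheory.OrderOfElement
import Mathlib.Data.ZMod.Basic
import Mathlib.Algebra.Group.TypeTags.Finite
import HarnessLib

/-!
# The profinite completion of a free group is torsion-free

Topic `Literature/GroupTheory/CombinatorialGroupTheory`; theorems only, Mathlib-only.  For a free
group `G` (any group carrying `IsFreeGroup`), the profinite completion `Ĝ = lim G ⧸ N` (Mathlib's
`ProfiniteGrp.ProfiniteCompletion.completion`, the limit over the finite-index normal subgroups `N`)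
has no nontrivial elements of finite order (`IsFreeGroup.eq_one_of_pow_eq_one_profiniteCompletion`).
This is the content of the sentence *"since [as is well-known] the abelianizations of all open
subgroups of `Ĝ` are torsion-free, we thus conclude that `Z_Ĝ(N̂) = {1}`"* in the proof of
Mochizuki, IUTchI, Lemma 2.7 (vi) (RIMS manuscript p. 59): what is used there is exactly that an
element of `Ĝ` of finite order is trivial.

## Proof (componentwise in the finite quotients; no cohomological dimension, no `Ẑ`-modules)

Let `z ∈ Ĝ`, `z ^ m = 1`, `m > 0`, and fix a finite-index normal `N₀`; put `a := z(N₀) ∈ G ⧸ N₀`, of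
order `c`.  The preimage `H ≤ G` of `⟨a⟩` has finite index, contains `N₀`, and is FREE
(Nielsen–Schreier, Mathlib's `subgroupIsFreeOfIsFree`); the projection `θ : H → ⟨a⟩ ≤ G ⧸ N₀`
therefore lifts through the INTEGERS: choosing `k_b ∈ ℤ` with `θ(b) = a^{k_b}` on a free basis gives
`σ : H → ℤ` with `θ(h) = a^{σ(h)}` for all `h`.  Let `K := Ker(H → ℤ → ℤ/mc)` and `N` the normal core
of `N₀ ∩ K` in `G` (finite index).  Writing `z(N) = f·N` with `f ∈ G`, coherence gives `f·N₀ = a`, so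
`f ∈ H`; and `z^m = 1` gives `f^m ∈ N ≤ K`, i.e. `mc ∣ m·σ(f)`, so `c ∣ σ(f)` and
`a = θ(f) = a^{σ(f)} = 1`.  Hence every component of `z` is trivial.

## References

* S. Mochizuki, *Inter-universal Teichmüller theory I*, §2, proof of Lemma 2.7 (vi), RIMS manuscript
  (2020) p. 59 — the sentence quoted above. [cite: Mochizuki2012, Lem 2.7(vi) proof p.59]
* L. Ribes, P. Zalesskii, *Profinite Groups*, 2nd ed., Springer (2010), §3.3–3.4 (free profinite
  groups; torsion-freeness via `cd ≤ 1`) — the classical route, not followed here. [RibesZalesskii2010]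
-/

namespace Literature.GroupTheory.CombinatorialGroupTheory

open CategoryTheory ProfiniteGrp

universe u

variable {G : Type u} [Group G]

/-- Coherence of an element of `Ĝ = lim G ⧸ N` in coset form: for `N ≤ M`, if the `N`-component is
`g·N` then the `M`-component is `g·M`. [cite: Mochizuki2012, Lem 2.7(vi) proof p.59] -/
private theorem val_eq_mk_of_le (x : ProfiniteCompletion.completion (GrpCat.of G))
    {N M : FiniteIndexNormalSubgroup G} (h : N ≤ M) (g : G)
    (hg : x.1 N = (QuotientGroup.mk g : G ⧸ N.toSubgroup)) :
    x.1 M = (QuotientGroup.mk g : G ⧸ M.toSubgroup) := by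
  have hx := x.property (homOfLE h)
  rw [← hx]
  change (ProfiniteCompletion.diagram (GrpCat.of G)).map (homOfLE h) (x.1 N) = _
  rw [hg]
  rfl

/-- Components of powers in `Ĝ`. [folklore] -/
private theorem pow_val (x : ProfiniteCompletion.completion (GrpCat.of G))
    (N : FiniteIndexNormalSubgroup G) (m : ℕ) : (x ^ m).1 N = (x.1 N) ^ m := by
  induction m with
  | zero => rfl
  | succ m ih => rw [pow_succ, pow_succ, ← ih]; rfl

/-- In a free group, a homomorphism onto a cyclic group `⟨a⟩` factors through the integers:
`θ(h) = a ^ σ(h)` for some `σ : H →* ℤ` (lift a free basis). [folklore] -/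
private theorem exists_hom_int_zpow {H Q : Type u} [Group H] [Group Q] [IsFreeGroup H] (θ : H →* Q)
    (a : Q) (hθ : ∀ h, θ h ∈ Subgroup.zpowers a) :
    ∃ σ : H →* Multiplicative ℤ, ∀ h, θ h = a ^ Multiplicative.toAdd (σ h) := by
  classical
  -- exponents on the free basis
  have hk : ∀ b : IsFreeGroup.Generators H, ∃ k : ℤ, a ^ k = θ (IsFreeGroup.of b) := fun b =>
    Subgroup.mem_zpowers_iff.mp (hθ _)
  choose k hk using hk
  refine ⟨IsFreeGroup.lift fun b => Multiplicative.ofAdd (k b), fun h => ?_⟩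
  -- both sides are homomorphisms agreeing on the basis
  have key : θ = (zpowersHom Q a).comp (IsFreeGroup.lift fun b => Multiplicative.ofAdd (k b)) := by
    refine IsFreeGroup.ext_hom (fun b => ?_)
    rw [MonoidHom.comp_apply, IsFreeGroup.lift_of, zpowersHom_apply, toAdd_ofAdd, hk b]
  conv_lhs => rw [key]
  rfl

/-- **The profinite completion of a free group is torsion-free**: for `G` free (`IsFreeGroup G`) and
`z ∈ Ĝ` with `z ^ m = 1`, `m > 0`, one has `z = 1`.  This is what the proof of [IUTchI] Lemma 2.7 (vi)
uses under the words *"the abelianizations of all open subgroups of `Ĝ` are torsion-free"*.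
[cite: Mochizuki2012, Lem 2.7(vi) proof p.59] -/
theorem _root_.IsFreeGroup.eq_one_of_pow_eq_one_profiniteCompletion [IsFreeGroup G]
    (z : ProfiniteCompletion.completion (GrpCat.of G)) {m : ℕ} (hm : 0 < m) (hz : z ^ m = 1) :
    z = 1 := by
  classical
  apply Subtype.ext
  funext N₀
  change z.1 N₀ = 1
  -- `a := z(N₀)`, `H :=` its preimage `≤ G`
  set a : G ⧸ N₀.toSubgroup := z.1 N₀ with ha
  let H : Subgroup G := (Subgroup.zpowers a).comap (QuotientGroup.mk' N₀.toSubgroup)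
  have hN₀H : N₀.toSubgroup ≤ H := fun n hn => by
    change QuotientGroup.mk' N₀.toSubgroup n ∈ Subgroup.zpowers a
    rw [QuotientGroup.mk'_apply, (QuotientGroup.eq_one_iff n).mpr hn]
    exact one_mem _
  haveI hHfi : H.FiniteIndex := by
    constructor
    rw [Subgroup.index_comap_of_surjective _ (QuotientGroup.mk'_surjective _)]
    exact Subgroup.FiniteIndex.index_ne_zero
  -- `θ : H → ⟨a⟩` and its integral lift `σ`
  let θ : H →* G ⧸ N₀.toSubgroup := (QuotientGroup.mk' N₀.toSubgroup).comp H.subtype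
  have hθ : ∀ h : H, θ h ∈ Subgroup.zpowers a := fun h => h.2
  obtain ⟨σ, hσ⟩ := exists_hom_int_zpow θ a hθ
  -- `c := ord a`, `K := Ker(H → ℤ/mc)`, `N := core(N₀ ∩ K)`
  set c : ℕ := orderOf a with hc
  have hc0 : 0 < c := (isOfFinOrder_of_finite a).orderOf_pos
  haveI : NeZero (m * c) := ⟨Nat.pos_iff_ne_zero.mp (Nat.mul_pos hm hc0)⟩
  let χ : Multiplicative ℤ →* Multiplicative (ZMod (m * c)) :=
    AddMonoidHom.toMultiplicative (Int.castAddHom (ZMod (m * c)))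
  let K : Subgroup H := (χ.comp σ).ker
  haveI : Finite (χ.comp σ).range := inferInstance
  haveI hKfi : K.FiniteIndex := Subgroup.finiteIndex_ker _
  let L : Subgroup G := N₀.toSubgroup ⊓ K.map H.subtype
  haveI hLfi : L.FiniteIndex := by
    haveI : (K.map H.subtype).FiniteIndex := by
      constructor
      rw [Subgroup.index_map, H.ker_subtype, sup_bot_eq, H.range_subtype]
      exact mul_ne_zero hKfi.index_ne_zero hHfi.index_ne_zero
    infer_instance
  let N : FiniteIndexNormalSubgroup G := FiniteIndexNormalSubgroup.ofSubgroup L.normalCore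
  have hNL : N.toSubgroup ≤ L := Subgroup.normalCore_le L
  have hNN₀ : N ≤ N₀ := fun g hg => (Subgroup.mem_inf.mp (hNL hg)).1
  -- a representative `f` of `z(N)`; coherence: `f·N₀ = a`, so `f ∈ H`
  obtain ⟨f, hf⟩ := QuotientGroup.mk_surjective (z.1 N)
  have hfN₀ : (QuotientGroup.mk f : G ⧸ N₀.toSubgroup) = a := (val_eq_mk_of_le z hNN₀ f hf.symm).symm
  have hfH : f ∈ H := by
    change QuotientGroup.mk' N₀.toSubgroup f ∈ Subgroup.zpowers a
    rw [QuotientGroup.mk'_apply, hfN₀]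
    exact Subgroup.mem_zpowers a
  -- `z^m = 1` gives `f^m ∈ N ≤ K`
  have hzN : (z.1 N) ^ m = 1 := by
    have h : (z ^ m).1 N = (1 : ProfiniteCompletion.completion (GrpCat.of G)).1 N := by rw [hz]
    rw [pow_val] at h
    exact h
  have hfm : f ^ m ∈ N.toSubgroup := by
    rw [← QuotientGroup.eq_one_iff, QuotientGroup.mk_pow, hf]
    exact hzN
  have hfmK : (⟨f, hfH⟩ : H) ^ m ∈ K := by
    have h1 : f ^ m ∈ K.map H.subtype := (Subgroup.mem_inf.mp (hNL hfm)).2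
    obtain ⟨k, hk, hkf⟩ := Subgroup.mem_map.mp h1
    have : k = ⟨f, hfH⟩ ^ m := Subtype.ext (by simpa using hkf)
    rw [← this]; exact hk
  -- hence `mc ∣ m σ(f)`, `c ∣ σ(f)`, `a ^ σ(f) = 1`
  set s : ℤ := Multiplicative.toAdd (σ ⟨f, hfH⟩) with hs
  have hdiv : ((m * c : ℕ) : ℤ) ∣ (m : ℤ) * s := by
    have h1 : (χ.comp σ) (⟨f, hfH⟩ ^ m) = 1 := hfmK
    rw [_root_.map_pow, MonoidHom.comp_apply] at h1
    have h2 : (((m : ℤ) * s : ℤ) : ZMod (m * c)) = 0 := by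
      have h3 := congrArg Multiplicative.toAdd h1
      rw [toAdd_pow, toAdd_one] at h3
      -- `toAdd (χ x) = (toAdd x : ZMod)`
      have h4 : Multiplicative.toAdd (χ (σ ⟨f, hfH⟩)) = ((s : ℤ) : ZMod (m * c)) := rfl
      rw [h4, nsmul_eq_mul] at h3
      push_cast
      exact h3
    exact (ZMod.intCast_zmod_eq_zero_iff_dvd _ _).mp h2
  have hcs : (c : ℤ) ∣ s := by
    have : ((m : ℤ) * c) ∣ (m : ℤ) * s := by exact_mod_cast hdiv
    exact Int.dvd_of_mul_dvd_mul_left (by exact_mod_cast hm.ne') this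
  have has : a ^ s = 1 := orderOf_dvd_iff_zpow_eq_one.mp (by rw [← hc]; exact hcs)
  -- `a = θ(f) = a ^ σ(f) = 1`
  have hθf : θ ⟨f, hfH⟩ = a := by
    change QuotientGroup.mk' N₀.toSubgroup f = a
    rw [QuotientGroup.mk'_apply, hfN₀]
  have hfin : a = 1 := by rw [← hθf, hσ ⟨f, hfH⟩, ← hs, has]
  exact hfin

/-- Torsion-freeness, order form: every element of finite order of the profinite completion of a free
group is trivial. [cite: Mochizuki2012, Lem 2.7(vi) proof p.59] -/
theorem _root_.IsFreeGroup.isOfFinOrder_profiniteCompletion_iff [IsFreeGroup G]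
    (z : ProfiniteCompletion.completion (GrpCat.of G)) : IsOfFinOrder z ↔ z = 1 := by
  refine ⟨fun h => ?_, fun h => h ▸ IsOfFinOrder.one⟩
  obtain ⟨m, hm, hzm⟩ := h.exists_pow_eq_one
  exact IsFreeGroup.eq_one_of_pow_eq_one_profiniteCompletion z hm hzm

/-- The free-group instance: for `F = F(ι)` and `z ∈ F̂` with `z ^ m = 1`, `m > 0`, one has `z = 1`.
[cite: Mochizuki2012, Lem 2.7(vi) proof p.59] -/
theorem _root_.FreeGroup.eq_one_of_pow_eq_one_profiniteCompletion {ι : Type u}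
    (z : ProfiniteCompletion.completion (GrpCat.of (FreeGroup ι))) {m : ℕ} (hm : 0 < m)
    (hz : z ^ m = 1) : z = 1 :=
  IsFreeGroup.eq_one_of_pow_eq_one_profiniteCompletion z hm hz

end Literature.GroupTheory.CombinatorialGroupTheory
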